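import Mathlib
import HarnessLib
import Summits.HubbardSuperconductivity.HubbardSuperconductivity.Theorems.KLProgrammeKLRegimeEngineTowerChernoffTwoLegSub
import Summits.HubbardSuperconductivity.HubbardSuperconductivity.Theorems.KLProgrammeKLRegimeEngineTowerBlockIncrWtPowAtKitSubTad
import Summits.HubbardSuperconductivity.HubbardSuperconductivity.Theorems.KLProgrammeKLRegimeEngineTowerWtPowStepLinkUniform

/-!
# Route `KLProgramme` — crux K3 ENGINE (stmt-HubbardSuperconductivity-20437 `KLRegimeEngineV17F2`), stub (b) / E1 interface (E2) in-tower route and located risk #17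
# «(C2)-MOMENTS» / located «(E2)-ROUTE-TADPOLE»: THE TWO-LEG TADPOLE-FREE BORN ROW OF EVERY BLOCK, EXPORTED FROM THE DEGREE-`Dw` LAW'S ROWS IN CLOSED FORM
# (recipe «(E2)-POW3-TRACK» item T6 «law with the m = 2 born row EXPORTED», HOME/hubbard-kl-k3c3-p2/g19/E2-POW3-TRACK-RECIPE.md §2/§3/§7; pen g27 (R472)(D), (R479);
#  cell gate-hubbard-kl, seat hubbard-kl-k3c3-p2 g20)

WHY.  The degree-`Dw` law `klTowerBornWtPowAt_le_law_of_inputs_base_tokX` (…TowerWtPowLawBaseTokX, W1 at weight power `Dw`) closes the IRRELEVANT degrees (`2p ≥ 6`) of the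
weighted track and exports, at every block `1 ≤ k ≤ K_b`, the measured profile rows (`4 ≤ m ≤ D`) and the token; the two- and four-leg measured inputs are imports (`ι₁`, `ι₂`).
What the (E2) reader (k3c2-p3 `klWtPinnedSumOf_two_klEffectiveAction_le_of_symbolData`, binders `hsup/h₀–h₃`) and #17-Z read per block is the BORN TWO-LEG size of the increment
— and, by the located item «(E2)-ROUTE-TADPOLE», of the increment WITHOUT ITS BLOCK TADPOLE `Δ_k − Δ_Γ 𝒱_{dk}` (the tadpole's bare-`U` part is exactly local and is booked
separately; the lump-sum two-leg born size is first order in the quartic input).  The sharp kit form (…TowerBlockIncrWtPowAtKitSubTad) keeps the door's «minus-one-line» shape: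
its first order reads the measured array with the input degrees `≤ 2` ZEROED.  This file turns that into a per-block CLOSED-FORM row from the law's own exported rows:

* (…TowerChernoffTwoLegSub, pure real analysis) `towerFO_trunc_one_le_of_fourPiece` — `towerFO D σ μ♭ 1 ≤ 15σ²(ι₃λ²) + A′(4Q′)·x₁³/(1−x₁)` (`μ♭ m := if 2 < m then μ m else 0`; six legs with two
  self-contracted pairs, eight legs on geometric); **`towerStepTwoSub_le_closed`** — the two-leg tadpole-free step in closed form on the FOUR-PIECE profile by
  `towerStep_le_of_chernoff` (generic in `p` and in the first-order bound; the born size shifted by `towerFO(μ) − towerFO(μ♭)`):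
  `b ≤ 15σ²(ι₃λ²) + A′(4Q′)·x₁³/(1−x₁) + e·ψ·G·(ΦG/(1−ΦG))`, `G = τ(ι₁λ + ι₂/(2Q′) + ι₃/(4Q′²) + A′Q′/4)` — NO `σ·ι₂` (tadpole) term; every summand is of second order in the
  imports (six-leg import; eight legs on; `(two- and four-leg imports)²` through `G·ΦG`);
* §1 **`klTowerBornWtPowSubTadAt_succ_le_kitStep_of_bounds`** — the tadpole-free degree-`Dw` block step at the k-free bounds (twin of W2 §1 on
  `klTowerBornWtPowSubTadAt_le_kit_units`), first order on the truncated scaled array; **`wtPowTwoLegSub_hstep_of_blockBounds`** — its `q = 0` instance in the literal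
  `hstep₂` shape, blocks `1 ≤ k ≤ K_b`, six names pinned by equations (as `wtPowLaw_hstep_of_blockBounds`);
* §2 **`klTowerBornWtPowSubTadAt_two_le_of_rows`** — from the law's THIRD conjunct (profile rows at every block), its FIRST conjunct (token), the imports and `hstep₂`, under
  the law's own numerics `hx₁ hx₂ hx₃ hy hθ`: `∀ k, 1 ≤ k ≤ K_b → klTowerBornWtPowSubTadAt … d k j Dw 2 / klLevUnitF β M 0 1 (dk) ≤ 15σ²(ι₃λ²) + A′(4Q′)x₁³/(1−x₁) + eψG·ΦG/(1−ΦG)`;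
  `klWtPinnedSumPow_two_subTad_le_of_rows` — the same per pin `(q, w)` in `klWtPinnedSumPow` currency, `klLevUnitF_zero_one : klLevUnitF β M 0 1 J = ε·(4^J)⁻¹`;
* (…TowerWtPowLawTwoLeg) `klTowerBornWtPowAt_le_law_of_inputs_base_tokX_twoLeg` — the law AND the two-leg export in one statement (W1's hypotheses + `hstep₂`).
Compositions of landed theorems and real algebra; block constants (`κ`, degree-`Dw` weighted `α`, `cr/cc`) are HYPOTHESES of the links (no supplier row: pen g27 (R465)(E)(iii)
STOP RULE); nothing asserts (E2), (X).3, (b), any stub, K3 or superconductivity.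
References: BGM 2006 §2.7 (2.70)–(2.71a), §2.8 (2.76)–(2.84), (2.93)–(2.98), §3 (3.2)–(3.8) [cite: BenfattoGiulianiMastropietro2006].
-/

noncomputable section

namespace Summit.HubbardSuperconductivity.HubbardSuperconductivity.Theorems.EngineV8

set_option linter.dupNamespace false -- summit = problem name (single-conjunct summit), D-0017

open Classical
open Real Finset Literature.MathematicalPhysics.QuantumLattice Literature.Probability.LatticeModels GrassmannAlgebra
open Literature.MathematicalPhysics.QuantumLattice.FermiRG
open Summit.HubbardSuperconductivity.HubbardSuperconductivity.Theorems.KLProgrammeLegKernels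
open Summit.HubbardSuperconductivity.HubbardSuperconductivity.Theorems.KLRegimeSplit
open Summit.HubbardSuperconductivity.HubbardSuperconductivity.Theorems.DispersionFlow

/-! ## §1 The TADPOLE-FREE degree-`Dw` weighted block step (`k ≥ 1`) at k-free bounds (twin of `klTowerBornWtPowAt_succ_le_kitStep_of_bounds`) -/

section Link

variable {L M : ℕ} [NeZero L] [NeZero M]

/-- **THE TADPOLE-FREE DEGREE-`Dw` WEIGHTED BLOCK STEP (`k ≥ 1`) AT k-FREE BOUNDS OF THE BLOCK DATA.**  As `klTowerBornWtPowAt_succ_le_kitStep_of_bounds`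
(…TowerWtPowStepLinkUniform) for the born array of the increment WITHOUT its block tadpole, `klTowerBornWtPowSubTadAt … d k j Dw (2(q+1)) / klLevUnitF β M 0 (q+1) (dk)`, from
the SHARP kit form `klTowerBornWtPowSubTadAt_le_kit_units` (…TowerBlockIncrWtPowAtKitSubTad): same k-independent parameters `σ̄ τ̄ ψ̄ Φ̄ W̄ Z̄`, the first order on the
truncated scaled array `μ̄♭ m := if q+2 < m then W̄·Z̄^m·klTowerMeasWtPowAt … (2m)/klLevUnitF β M 0 m (dk−1) else 0`.
[cite: BenfattoGiulianiMastropietro2006, (2.70)-(2.71a), §2.8 (2.76)-(2.84), §3 (3.2)-(3.8)] -/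
theorem klTowerBornWtPowSubTadAt_succ_le_kitStep_of_bounds {β : ℝ} (hβ : 0 < β) (U μ : ℝ) (K : TrigPolyC4v) {d k : ℕ} (j Dw : ℕ) (hd : 1 ≤ d)
    (hk : 1 ≤ k)
    (hZ : hubbardEffPartitionFnCT L M β U μ 0 K (klScale klE0 (d * k)) ≠ 0)
    {κ κb : ℝ} (hκ : 0 < κ) (hκb : 0 < κb) (hκκb : κ ^ 2 * (8 : ℝ) ^ (d * k) ≤ κb ^ 2)
    (hGB : IsGramBoundedR ((sectorSubMatrix L M β (bgmFatMultiplier L M klE0 β (nambuXiCT L μ K) (d * k - 1))).transpose *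
      hubbardCovSliceCT L M β μ 0 K (klScale klE0 (d * (k + 1))) (klScale klE0 (d * k)) *
        sectorSubMatrix L M β (bgmFatMultiplier L M klE0 β (nambuXiCT L μ K) (d * k - 1))) κ)
    {α αb : ℝ} (hαb : 0 < αb) (hααb : α ≤ αb * (4 : ℝ) ^ (d * k))
    (hrow : ∀ X, ∑ Y, ‖((sectorSubMatrix L M β (bgmFatMultiplier L M klE0 β (nambuXiCT L μ K) (d * k - 1))).transpose *
        hubbardCovSliceCT L M β μ 0 K (klScale klE0 (d * (k + 1))) (klScale klE0 (d * k)) *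
          sectorSubMatrix L M β (bgmFatMultiplier L M klE0 β (nambuXiCT L μ K) (d * k - 1))) X Y‖ *
        klScaleWtPow L M β j Dw {latticeLegPos (2 * (2 * M)) X, latticeLegPos (2 * (2 * M)) Y} ≤ α)
    (hcol : ∀ Y, ∑ X, ‖((sectorSubMatrix L M β (bgmFatMultiplier L M klE0 β (nambuXiCT L μ K) (d * k - 1))).transpose *
        hubbardCovSliceCT L M β μ 0 K (klScale klE0 (d * (k + 1))) (klScale klE0 (d * k)) *
          sectorSubMatrix L M β (bgmFatMultiplier L M klE0 β (nambuXiCT L μ K) (d * k - 1))) X Y‖ *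
        klScaleWtPow L M β j Dw {latticeLegPos (2 * (2 * M)) X, latticeLegPos (2 * (2 * M)) Y} ≤ α)
    {crb ccb : ℝ} (hcrb : 0 < crb) (hccb : 0 < ccb)
    (hrow' : ∀ X'', ∑ X', ‖(sectorAnalysisMatrix L M β (klAnisoFamily L M β μ K klE0 (d * k)) *
        sectorSubMatrix L M β (bgmFatMultiplier L M klE0 β (nambuXiCT L μ K) (d * k - 1))) X'' X'‖ *
        klScaleWtPow L M β j Dw {latticeLegPos (2 * (2 * M)) X'', latticeLegPos (2 * (2 * M)) X'} ≤ crb)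
    (hcol' : ∀ X', ∑ X'', ‖(sectorAnalysisMatrix L M β (klAnisoFamily L M β μ K klE0 (d * k)) *
        sectorSubMatrix L M β (bgmFatMultiplier L M klE0 β (nambuXiCT L μ K) (d * k - 1))) X'' X'‖ *
        klScaleWtPow L M β j Dw {latticeLegPos (2 * (2 * M)) X'', latticeLegPos (2 * (2 * M)) X'} ≤ ccb)
    {D : ℕ} (hD : Fintype.card (SpaceTimeIdx L M × SectorLeg (sectorCount (d * k - 1))) / 2 ≤ D)
    {N : ℕ} (hN : 1 ≤ N)
    (hguard : exp 1 * αb * ccb / (κb ^ 2 * crb) *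
      towerV D (4 * exp 4 * κb ^ 2 / ccb ^ 2)
        (fun m => 32 * crb / ccb * (imagTimeWeight β M ^ 2 * ccb ^ 2 / 8) ^ m *
          (klTowerMeasWtPowAt L M β U μ K d k j Dw (2 * m) / klLevUnitF β M 0 m (d * k - 1))) < 1)
    (q : ℕ) :
    klTowerBornWtPowSubTadAt L M β U μ K d k j Dw (2 * (q + 1)) / klLevUnitF β M 0 (q + 1) (d * k) ≤
      towerFO D (κb ^ 2 / ccb ^ 2)
          (fun m => if q + 2 < m then 32 * crb / ccb * (imagTimeWeight β M ^ 2 * ccb ^ 2 / 8) ^ m *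
            (klTowerMeasWtPowAt L M β U μ K d k j Dw (2 * m) / klLevUnitF β M 0 m (d * k - 1)) else 0) (q + 1) +
        ∑ n ∈ Icc 2 N, exp 1 * (exp 1 * αb * ccb / (κb ^ 2 * crb)) ^ (n - 1) * (ccb ^ 2 / κb ^ 2) ^ (q + 1) *
          towerS D (4 * exp 4 * κb ^ 2 / ccb ^ 2)
            (fun m => 32 * crb / ccb * (imagTimeWeight β M ^ 2 * ccb ^ 2 / 8) ^ m *
              (klTowerMeasWtPowAt L M β U μ K d k j Dw (2 * m) / klLevUnitF β M 0 m (d * k - 1))) n (q + 1) +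
        (ccb ^ 2 / κb ^ 2) ^ (q + 1) * exp 1 *
          towerV D (4 * exp 4 * κb ^ 2 / ccb ^ 2)
            (fun m => 32 * crb / ccb * (imagTimeWeight β M ^ 2 * ccb ^ 2 / 8) ^ m *
              (klTowerMeasWtPowAt L M β U μ K d k j Dw (2 * m) / klLevUnitF β M 0 m (d * k - 1))) *
          (exp 1 * αb * ccb / (κb ^ 2 * crb) *
            towerV D (4 * exp 4 * κb ^ 2 / ccb ^ 2)
              (fun m => 32 * crb / ccb * (imagTimeWeight β M ^ 2 * ccb ^ 2 / 8) ^ m *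
                (klTowerMeasWtPowAt L M β U μ K d k j Dw (2 * m) / klLevUnitF β M 0 m (d * k - 1)))) ^ N /
          (1 - exp 1 * αb * ccb / (κb ^ 2 * crb) *
            towerV D (4 * exp 4 * κb ^ 2 / ccb ^ 2)
              (fun m => 32 * crb / ccb * (imagTimeWeight β M ^ 2 * ccb ^ 2 / 8) ^ m *
                (klTowerMeasWtPowAt L M β U μ K d k j Dw (2 * m) / klLevUnitF β M 0 m (d * k - 1)))) := by
  have hx : 0 < imagTimeWeight β M := imagTimeWeight_pos_of_pos (M := M) hβ
  have hJ₁ : 1 ≤ d * k := le_trans hk (Nat.le_mul_of_pos_left k (by omega))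
  have h8 : (0 : ℝ) < (8 : ℝ) ^ (d * k) := by positivity
  have he1 : 0 < exp 1 := exp_pos 1
  have he4' : exp 4 = exp 2 ^ 2 := by rw [← Real.exp_nat_mul]; norm_num
  -- the Gram constant at the bound: `κ′ ≥ κ`, `κ′²·8^{dk} = κ̄²`
  obtain ⟨κ', hκ'0, hκκ', hκ'sq⟩ := exists_sqrt_scaled hκ hκb h8 hκκb
  have hGB' := TorusFourierL2.isGramBoundedR_of_le hGB hκ.le hκκ'
  -- the decay constant at the bound
  have hα'0 : 0 < αb * (4 : ℝ) ^ (d * k) := by positivity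
  have hrow2 : ∀ X, ∑ Y, ‖((sectorSubMatrix L M β (bgmFatMultiplier L M klE0 β (nambuXiCT L μ K) (d * k - 1))).transpose *
      hubbardCovSliceCT L M β μ 0 K (klScale klE0 (d * (k + 1))) (klScale klE0 (d * k)) *
        sectorSubMatrix L M β (bgmFatMultiplier L M klE0 β (nambuXiCT L μ K) (d * k - 1))) X Y‖ *
        klScaleWtPow L M β j Dw {latticeLegPos (2 * (2 * M)) X, latticeLegPos (2 * (2 * M)) Y} ≤ αb * (4 : ℝ) ^ (d * k) :=
    fun X => (hrow X).trans hααb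
  have hcol2 : ∀ Y, ∑ X, ‖((sectorSubMatrix L M β (bgmFatMultiplier L M klE0 β (nambuXiCT L μ K) (d * k - 1))).transpose *
      hubbardCovSliceCT L M β μ 0 K (klScale klE0 (d * (k + 1))) (klScale klE0 (d * k)) *
        sectorSubMatrix L M β (bgmFatMultiplier L M klE0 β (nambuXiCT L μ K) (d * k - 1))) X Y‖ *
        klScaleWtPow L M β j Dw {latticeLegPos (2 * (2 * M)) X, latticeLegPos (2 * (2 * M)) Y} ≤ αb * (4 : ℝ) ^ (d * k) :=
    fun Y => (hcol Y).trans hααb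
  -- abbreviations: the input boundary's units, the unit-free measured array, the parameters
  set ε : ℝ := imagTimeWeight β M with hε
  set Kc : ℝ := ε * ((((2 : ℝ) ^ (5 * (d * k - 1))))⁻¹ * (ε ^ 2)⁻¹) with hKc
  set u : ℝ := (8 : ℝ) ^ (d * k - 1) * ε ^ 2 with hu
  set μ₁ : ℕ → ℝ := fun m => klTowerMeasWtPowAt L M β U μ K d k j Dw (2 * m) / klLevUnitF β M 0 m (d * k - 1) with hμ₁
  set W : ℝ := 32 * crb / ccb with hW
  set Z : ℝ := ε ^ 2 * ccb ^ 2 / 8 with hZ'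
  set σb : ℝ := κb ^ 2 / ccb ^ 2 with hσb
  set τb : ℝ := 4 * exp 4 * κb ^ 2 / ccb ^ 2 with hτb
  set ψb : ℝ := ccb ^ 2 / κb ^ 2 with hψb
  set Φb : ℝ := exp 1 * αb * ccb / (κb ^ 2 * crb) with hΦb
  have hKc0 : 0 < Kc := by positivity
  have hu0 : 0 < u := by positivity
  have hW0 : 0 < W := by positivity
  have hZ0 : 0 < Z := by positivity
  -- `8^{dk} = 8^{dk−1}·8`, `4^{dk} = 4^{dk−1}·4`, `2^{5(dk−1)} = 4^{dk−1}·8^{dk−1}`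
  have h8succ : (8 : ℝ) ^ (d * k) = (8 : ℝ) ^ (d * k - 1) * 8 := by rw [← pow_succ, Nat.sub_add_cancel hJ₁]
  have h4succ : (4 : ℝ) ^ (d * k) = (4 : ℝ) ^ (d * k - 1) * 4 := by rw [← pow_succ, Nat.sub_add_cancel hJ₁]
  have h32 : (2 : ℝ) ^ (5 * (d * k - 1)) = (4 : ℝ) ^ (d * k - 1) * (8 : ℝ) ^ (d * k - 1) := by
    rw [← mul_pow, show (4 : ℝ) * 8 = 2 ^ 5 by norm_num, ← pow_mul]
  have h8p : (0 : ℝ) < (8 : ℝ) ^ (d * k - 1) := by positivity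
  have h4p : (0 : ℝ) < (4 : ℝ) ^ (d * k - 1) := by positivity
  -- the carrier quotient in product units is `μ₁` (plain and truncated); the absolute input sizes are `(ε·K_c)·(u^m·μ₁ m)`
  have hμeq : (fun m : ℕ => klTowerMeasWtPowAt L M β U μ K d k j Dw (2 * m) / (Kc * u ^ m)) = μ₁ := by
    rw [hμ₁, hKc, hu, hε]; exact towerMeasWtPowAt_div_units_eq hβ U μ K d k j Dw
  have hμeq' : (fun m : ℕ => if q + 2 < m then klTowerMeasWtPowAt L M β U μ K d k j Dw (2 * m) / (Kc * u ^ m) else 0) =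
      fun m : ℕ => if q + 2 < m then μ₁ m else 0 := by
    funext m
    split_ifs
    · exact congrFun hμeq m
    · rfl
  have habs : (fun m : ℕ => imagTimeWeight β M * klTowerMeasWtPowAt L M β U μ K d k j Dw (2 * m)) =
      fun m : ℕ => (ε * Kc) * (u ^ m * μ₁ m) := by
    rw [← hμeq]; exact towerInputSizes_units (ε := ε) hu0.ne' hKc0.ne' (fun m => klTowerMeasWtPowAt L M β U μ K d k j Dw m)
  -- the scaled arrays in product form
  have hμbar : (fun m : ℕ => 32 * crb / ccb * (imagTimeWeight β M ^ 2 * ccb ^ 2 / 8) ^ m *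
      (klTowerMeasWtPowAt L M β U μ K d k j Dw (2 * m) / klLevUnitF β M 0 m (d * k - 1))) = fun m : ℕ => W * (Z ^ m * μ₁ m) := by
    funext m; simp only [hW, hZ', hμ₁, hε]; ring
  have hμbar' : (fun m : ℕ => if q + 2 < m then 32 * crb / ccb * (imagTimeWeight β M ^ 2 * ccb ^ 2 / 8) ^ m *
      (klTowerMeasWtPowAt L M β U μ K d k j Dw (2 * m) / klLevUnitF β M 0 m (d * k - 1)) else 0) =
      fun m : ℕ => W * (Z ^ m * (if q + 2 < m then μ₁ m else 0)) := by
    funext m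
    split_ifs
    · simp only [hW, hZ', hμ₁, hε]; ring
    · simp
  -- the four parameter identities and the output constant
  have hσeq : σb * Z = κ' ^ 2 * u := by
    simp only [hσb, hZ', hu]; rw [← hκ'sq, h8succ]; field_simp
  have hτeq : τb * Z = (exp 2 * (κ' + κ')) ^ 2 * u := by
    simp only [hτb, hZ', hu]; rw [← hκ'sq, h8succ, he4']; field_simp; ring
  have hψeq : ψb / Z = κ'⁻¹ ^ 2 / u := by
    simp only [hψb, hZ', hu]; rw [← hκ'sq, h8succ, inv_pow]; field_simp
  have hΦeq : Φb * W = exp 1 * (αb * (4 : ℝ) ^ (d * k)) / κ' ^ 2 * (ε * Kc) := by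
    simp only [hΦb, hW, hKc]
    rw [← hκ'sq, h8succ, h4succ, h32]
    field_simp
    ring
  -- the guard of the kit form, from the final guard
  have hguardkit : exp 1 * (αb * (4 : ℝ) ^ (d * k)) / κ' ^ 2 *
      towerV D ((exp 2 * (κ' + κ')) ^ 2) (fun m' => imagTimeWeight β M * klTowerMeasWtPowAt L M β U μ K d k j Dw (2 * m')) < 1 := by
    have key : exp 1 * (αb * (4 : ℝ) ^ (d * k)) / κ' ^ 2 *
        towerV D ((exp 2 * (κ' + κ')) ^ 2) (fun m' => imagTimeWeight β M * klTowerMeasWtPowAt L M β U μ K d k j Dw (2 * m')) =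
        Φb * towerV D τb (fun m => 32 * crb / ccb * (imagTimeWeight β M ^ 2 * ccb ^ 2 / 8) ^ m *
          (klTowerMeasWtPowAt L M β U μ K d k j Dw (2 * m) / klLevUnitF β M 0 m (d * k - 1))) := by
      rw [habs, hμbar, towerV_units, towerV_units, hτeq]
      calc exp 1 * (αb * (4 : ℝ) ^ (d * k)) / κ' ^ 2 * ((ε * Kc) * towerV D ((exp 2 * (κ' + κ')) ^ 2 * u) μ₁)
          = (exp 1 * (αb * (4 : ℝ) ^ (d * k)) / κ' ^ 2 * (ε * Kc)) * towerV D ((exp 2 * (κ' + κ')) ^ 2 * u) μ₁ := by ring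
        _ = (Φb * W) * towerV D ((exp 2 * (κ' + κ')) ^ 2 * u) μ₁ := by rw [hΦeq]
        _ = Φb * (W * towerV D ((exp 2 * (κ' + κ')) ^ 2 * u) μ₁) := by ring
    rw [key]; exact hguard
  -- (1) the sharp kit form at the input boundary's units, truncation `N + 1`, radius `ρ := κ′`
  have hN₁ : 2 ≤ N + 1 := by omega
  have h1 := klTowerBornWtPowSubTadAt_le_kit_units (L := L) (M := M) hβ U μ K j Dw hd hk hZ hκ'0 hGB' hα'0 hrow2 hcol2 hκ'0 hD hguardkit hcrb.le
    hccb.le hrow' hcol' hN₁ q hu0 hKc0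
  rw [hμeq', hμeq, Nat.add_sub_cancel] at h1
  -- (2) the final kit bracket in the input units (first order on the truncated array)
  have hkit := kitStep_abs_eq_units_mul_trunc (K := W) (u := Z) hW0.ne' hZ0.ne' D σb τb Φb ψb μ₁ (fun m => if q + 2 < m then μ₁ m else 0) N (q + 1)
  rw [hσeq, hτeq, hΦeq, hψeq] at hkit
  -- (3) divide by the output unit
  have hunit : klLevUnitF β M 0 (q + 1) (d * k) = (Kc * u ^ (q + 1)) * ((8 : ℝ) ^ (q + 1) / 32) := by
    rw [hKc, hu, hε]; exact klLevUnitF_zero_track_succ_units (M := M) hβ hJ₁ (by omega)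
  have hU0 : 0 < klLevUnitF β M 0 (q + 1) (d * k) := klLevUnitF_pos hβ 0 _ _
  have hout : (imagTimeWeight β M * crb) * (imagTimeWeight β M * ccb) ^ (2 * q + 1) * (u ^ (q + 1) * Kc) =
      (Z ^ (q + 1) * W) * ((Kc * u ^ (q + 1)) * ((8 : ℝ) ^ (q + 1) / 32)) := by
    simp only [hZ', hW, hε, div_pow, mul_pow, ← pow_mul]
    field_simp
    ring
  rw [hμbar, hμbar', hkit, div_le_iff₀ hU0, hunit]
  refine h1.trans (le_of_eq ?_)
  rw [hout]
  ring

/-- **THE k-UNIFORM TADPOLE-FREE TWO-LEG LINK**: the two-leg step binder `hstep₂` of `klTowerBornWtPowSubTadAt_two_le_of_rows` VERBATIM — blocks `1 ≤ k ≤ K_b`, token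
`Zk k := Z^K_{Λ_{dk}} ≠ 0`, the six names `W Z σ τ ψ Φ` pinned by equations (instantiate with `rfl`) exactly as in `wtPowLaw_hstep_of_blockBounds` — from the per-block Gram,
degree-`Dw` weighted decay and weighted overlap data under the k-free bounds, at output degree two (`q = 0`): first order on the truncated array (no quartic input).
[cite: BenfattoGiulianiMastropietro2006, (2.70)-(2.71a), §2.8 (2.76)-(2.84), §3 (3.2)-(3.8)] -/
theorem wtPowTwoLegSub_hstep_of_blockBounds {β : ℝ} (hβ : 0 < β) (U μ : ℝ) (K : TrigPolyC4v) {d : ℕ} (hd : 1 ≤ d) (j Dw Kb : ℕ)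
    {κb αb crb ccb : ℝ} (hκb : 0 < κb) (hαb : 0 < αb) (hcrb : 0 < crb) (hccb : 0 < ccb)
    (κ α : ℕ → ℝ) (hκ : ∀ k, 1 ≤ k → k ≤ Kb → 0 < κ k) (hκκb : ∀ k, 1 ≤ k → k ≤ Kb → κ k ^ 2 * (8 : ℝ) ^ (d * k) ≤ κb ^ 2)
    (hααb : ∀ k, 1 ≤ k → k ≤ Kb → α k ≤ αb * (4 : ℝ) ^ (d * k))
    (hGB : ∀ k, 1 ≤ k → k ≤ Kb → IsGramBoundedR ((sectorSubMatrix L M β (bgmFatMultiplier L M klE0 β (nambuXiCT L μ K) (d * k - 1))).transpose *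
      hubbardCovSliceCT L M β μ 0 K (klScale klE0 (d * (k + 1))) (klScale klE0 (d * k)) *
        sectorSubMatrix L M β (bgmFatMultiplier L M klE0 β (nambuXiCT L μ K) (d * k - 1))) (κ k))
    (hrow : ∀ k, 1 ≤ k → k ≤ Kb → ∀ X, ∑ Y, ‖((sectorSubMatrix L M β (bgmFatMultiplier L M klE0 β (nambuXiCT L μ K) (d * k - 1))).transpose *
        hubbardCovSliceCT L M β μ 0 K (klScale klE0 (d * (k + 1))) (klScale klE0 (d * k)) *
          sectorSubMatrix L M β (bgmFatMultiplier L M klE0 β (nambuXiCT L μ K) (d * k - 1))) X Y‖ *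
        klScaleWtPow L M β j Dw {latticeLegPos (2 * (2 * M)) X, latticeLegPos (2 * (2 * M)) Y} ≤ α k)
    (hcol : ∀ k, 1 ≤ k → k ≤ Kb → ∀ Y, ∑ X, ‖((sectorSubMatrix L M β (bgmFatMultiplier L M klE0 β (nambuXiCT L μ K) (d * k - 1))).transpose *
        hubbardCovSliceCT L M β μ 0 K (klScale klE0 (d * (k + 1))) (klScale klE0 (d * k)) *
          sectorSubMatrix L M β (bgmFatMultiplier L M klE0 β (nambuXiCT L μ K) (d * k - 1))) X Y‖ *
        klScaleWtPow L M β j Dw {latticeLegPos (2 * (2 * M)) X, latticeLegPos (2 * (2 * M)) Y} ≤ α k)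
    (hrow' : ∀ k, 1 ≤ k → k ≤ Kb → ∀ X'', ∑ X', ‖(sectorAnalysisMatrix L M β (klAnisoFamily L M β μ K klE0 (d * k)) *
        sectorSubMatrix L M β (bgmFatMultiplier L M klE0 β (nambuXiCT L μ K) (d * k - 1))) X'' X'‖ *
        klScaleWtPow L M β j Dw {latticeLegPos (2 * (2 * M)) X'', latticeLegPos (2 * (2 * M)) X'} ≤ crb)
    (hcol' : ∀ k, 1 ≤ k → k ≤ Kb → ∀ X', ∑ X'', ‖(sectorAnalysisMatrix L M β (klAnisoFamily L M β μ K klE0 (d * k)) *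
        sectorSubMatrix L M β (bgmFatMultiplier L M klE0 β (nambuXiCT L μ K) (d * k - 1))) X'' X'‖ *
        klScaleWtPow L M β j Dw {latticeLegPos (2 * (2 * M)) X'', latticeLegPos (2 * (2 * M)) X'} ≤ ccb)
    {D : ℕ} (hD : ∀ k, 1 ≤ k → k ≤ Kb → Fintype.card (SpaceTimeIdx L M × SectorLeg (sectorCount (d * k - 1))) / 2 ≤ D)
    (W Z σ τ ψ Φ : ℝ) (hW : W = 32 * crb / ccb) (hZ : Z = imagTimeWeight β M ^ 2 * ccb ^ 2 / 8)
    (hσ : σ = κb ^ 2 / ccb ^ 2) (hτ : τ = 4 * exp 4 * κb ^ 2 / ccb ^ 2) (hψ : ψ = ccb ^ 2 / κb ^ 2)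
    (hΦ : Φ = exp 1 * αb * ccb / (κb ^ 2 * crb)) :
    ∀ k, 1 ≤ k → k ≤ Kb → hubbardEffPartitionFnCT L M β U μ 0 K (klScale klE0 (d * k)) ≠ 0 → ∀ N : ℕ, 2 ≤ N →
      Φ * towerV D τ (fun m => W * Z ^ m * (klTowerMeasWtPowAt L M β U μ K d k j Dw (2 * m) / klLevUnitF β M 0 m (d * k - 1))) < 1 →
      klTowerBornWtPowSubTadAt L M β U μ K d k j Dw 2 / klLevUnitF β M 0 1 (d * k) ≤
        towerFO D σ (fun m => if 2 < m then W * Z ^ m * (klTowerMeasWtPowAt L M β U μ K d k j Dw (2 * m) / klLevUnitF β M 0 m (d * k - 1)) else 0) 1 +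
          ∑ n ∈ Icc 2 N, exp 1 * Φ ^ (n - 1) * ψ ^ 1 *
            towerS D τ (fun m => W * Z ^ m * (klTowerMeasWtPowAt L M β U μ K d k j Dw (2 * m) / klLevUnitF β M 0 m (d * k - 1))) n 1 +
          ψ ^ 1 * exp 1 * towerV D τ (fun m => W * Z ^ m * (klTowerMeasWtPowAt L M β U μ K d k j Dw (2 * m) / klLevUnitF β M 0 m (d * k - 1))) *
            (Φ * towerV D τ (fun m => W * Z ^ m * (klTowerMeasWtPowAt L M β U μ K d k j Dw (2 * m) / klLevUnitF β M 0 m (d * k - 1)))) ^ N /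
            (1 - Φ * towerV D τ (fun m => W * Z ^ m * (klTowerMeasWtPowAt L M β U μ K d k j Dw (2 * m) / klLevUnitF β M 0 m (d * k - 1)))) := by
  intro k hk1 hkK hZk N hN hguard
  subst hW hZ hσ hτ hψ hΦ
  have h := klTowerBornWtPowSubTadAt_succ_le_kitStep_of_bounds hβ U μ K j Dw hd hk1 hZk (hκ k hk1 hkK) hκb (hκκb k hk1 hkK) (hGB k hk1 hkK) hαb
    (hααb k hk1 hkK) (hrow k hk1 hkK) (hcol k hk1 hkK) hcrb hccb (hrow' k hk1 hkK) (hcol' k hk1 hkK) (hD k hk1 hkK) (N := N) (by omega) hguard 0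
  simpa only [Nat.zero_add, mul_one, pow_one] using h

end Link

/-! ## §2 The two-leg TADPOLE-FREE born row of every block from the law's exported rows (four-piece profile, closed form) -/

section Export

variable {L M : ℕ} [NeZero L]

/-- **THE TWO-LEG TADPOLE-FREE BORN ROW OF EVERY BLOCK, FROM THE LAW'S ROWS.**  Given, at every block `1 ≤ k ≤ K_b`: the measured profile rows
`W·Z^m·klTowerMeasWtPowAt … d k j Dw (2m)/klLevUnitF β M 0 m (dk−1) ≤ A′λ^{m−1}Q′^m` (`4 ≤ m ≤ D`; the THIRD conjunct of `klTowerBornWtPowAt_le_law_of_inputs_base_tokX`),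
the imports `ι₁ ι₂ ι₃` (degrees `2, 4, 6`), the token `Zk k` (its FIRST conjunct) and the tadpole-free two-leg step in the kit's literal form (`wtPowTwoLegSub_hstep_of_blockBounds`
serves it), and the kit's numerics `x₁ < 1`, `2λτQ′ ≤ 1`, `x₃ < 1`, `y < 1`, `θ̄ < 1` (the law's own `hx₁ hx₂ hx₃ hy hθ`): at every block `1 ≤ k ≤ K_b`,
`klTowerBornWtPowSubTadAt … d k j Dw 2 / klLevUnitF β M 0 1 (dk) ≤ 15σ²(ι₃λ²) + A′(4Q′)·x₁³/(1−x₁) + e·ψ·G·(ΦG/(1−ΦG))`, `G = τ(ι₁λ + ι₂/(2Q′) + ι₃/(4Q′²) + A′Q′/4)` —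
second order in the imports, no tadpole term. [cite: BenfattoGiulianiMastropietro2006, (2.70)-(2.71a), §2.8 (2.83), (2.93)-(2.98)] -/
theorem klTowerBornWtPowSubTadAt_two_le_of_rows {β : ℝ} (U μ : ℝ) (K : TrigPolyC4v)
    (j d Kb D Dw : ℕ) {lam W Z A' Q' σ Φ ψ τ ι₁ ι₂ ι₃ : ℝ} {Zk : ℕ → Prop}
    (hlam : 0 < lam) (hA'0 : 0 ≤ A') (hQ'0 : 0 < Q') (hσ : 0 ≤ σ) (hΦ : 0 ≤ Φ) (hψ : 0 ≤ ψ) (hτ : 0 < τ)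
    (hμ0 : ∀ k m, 0 ≤ W * Z ^ m * (klTowerMeasWtPowAt L M β U μ K d k j Dw (2 * m) / klLevUnitF β M 0 m (d * k - 1)))
    -- the law's exported rows: measured profile at every block, imports, token
    (hprof : ∀ k, 1 ≤ k → k ≤ Kb → ∀ m, 4 ≤ m → m ≤ D →
      W * Z ^ m * (klTowerMeasWtPowAt L M β U μ K d k j Dw (2 * m) / klLevUnitF β M 0 m (d * k - 1)) ≤ A' * lam ^ (m - 1) * Q' ^ m)
    (hι₁ : ∀ k, 1 ≤ k → k ≤ Kb → W * Z ^ 1 * (klTowerMeasWtPowAt L M β U μ K d k j Dw (2 * 1) / klLevUnitF β M 0 1 (d * k - 1)) ≤ ι₁ * lam)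
    (hι₂ : ∀ k, 1 ≤ k → k ≤ Kb → W * Z ^ 2 * (klTowerMeasWtPowAt L M β U μ K d k j Dw (2 * 2) / klLevUnitF β M 0 2 (d * k - 1)) ≤ ι₂ * lam)
    (hι₃ : ∀ k, 1 ≤ k → k ≤ Kb → W * Z ^ 3 * (klTowerMeasWtPowAt L M β U μ K d k j Dw (2 * 3) / klLevUnitF β M 0 3 (d * k - 1)) ≤ ι₃ * lam ^ 2)
    (hZall : ∀ k, 1 ≤ k → k ≤ Kb → Zk k)
    -- the tadpole-free two-leg step at blocks 1 ≤ k ≤ Kb, which may use the token at its own block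
    (hstep₂ : ∀ k, 1 ≤ k → k ≤ Kb → Zk k → ∀ N : ℕ, 2 ≤ N →
      Φ * towerV D τ (fun m => W * Z ^ m * (klTowerMeasWtPowAt L M β U μ K d k j Dw (2 * m) / klLevUnitF β M 0 m (d * k - 1))) < 1 →
      klTowerBornWtPowSubTadAt L M β U μ K d k j Dw 2 / klLevUnitF β M 0 1 (d * k) ≤
        towerFO D σ (fun m => if 2 < m then W * Z ^ m * (klTowerMeasWtPowAt L M β U μ K d k j Dw (2 * m) / klLevUnitF β M 0 m (d * k - 1)) else 0) 1 +
          ∑ n ∈ Icc 2 N, exp 1 * Φ ^ (n - 1) * ψ ^ 1 *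
            towerS D τ (fun m => W * Z ^ m * (klTowerMeasWtPowAt L M β U μ K d k j Dw (2 * m) / klLevUnitF β M 0 m (d * k - 1))) n 1 +
          ψ ^ 1 * exp 1 * towerV D τ (fun m => W * Z ^ m * (klTowerMeasWtPowAt L M β U μ K d k j Dw (2 * m) / klLevUnitF β M 0 m (d * k - 1))) *
            (Φ * towerV D τ (fun m => W * Z ^ m * (klTowerMeasWtPowAt L M β U μ K d k j Dw (2 * m) / klLevUnitF β M 0 m (d * k - 1)))) ^ N /
            (1 - Φ * towerV D τ (fun m => W * Z ^ m * (klTowerMeasWtPowAt L M β U μ K d k j Dw (2 * m) / klLevUnitF β M 0 m (d * k - 1)))))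
    -- the kit's numerics (the law's own)
    (hx₁ : 4 * σ * lam * Q' < 1) (hx₂ : 2 * lam * τ * Q' ≤ 1) (hx₃ : exp 1 * τ * lam * Q' < 1)
    (hy : Φ * (τ * (ι₁ * lam + ι₂ / (2 * Q') + ι₃ / (4 * Q' ^ 2) + A' * Q' / 4)) < 1)
    (hθ : Φ * (exp 1 * τ * (ι₁ * lam) + (exp 1 * τ) ^ 2 * (ι₂ * lam) + (exp 1 * τ) ^ 3 * (ι₃ * lam ^ 2) +
      A' * (exp 1 * τ * Q') * ((exp 1 * τ * lam * Q') ^ 3 / (1 - exp 1 * τ * lam * Q'))) < 1) :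
    ∀ k, 1 ≤ k → k ≤ Kb →
      klTowerBornWtPowSubTadAt L M β U μ K d k j Dw 2 / klLevUnitF β M 0 1 (d * k) ≤
        15 * σ ^ 2 * (ι₃ * lam ^ 2) + A' * (4 * Q') * ((4 * σ * lam * Q') ^ 3 / (1 - 4 * σ * lam * Q')) +
          exp 1 * ψ * (τ * (ι₁ * lam + ι₂ / (2 * Q') + ι₃ / (4 * Q' ^ 2) + A' * Q' / 4)) *
            (Φ * (τ * (ι₁ * lam + ι₂ / (2 * Q') + ι₃ / (4 * Q' ^ 2) + A' * Q' / 4)) /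
              (1 - Φ * (τ * (ι₁ * lam + ι₂ / (2 * Q') + ι₃ / (4 * Q' ^ 2) + A' * Q' / 4)))) := by
  intro k hk1 hkK
  exact towerStepTwoSub_le_closed (D := D)
    (μ := fun m => W * Z ^ m * (klTowerMeasWtPowAt L M β U μ K d k j Dw (2 * m) / klLevUnitF β M 0 m (d * k - 1)))
    hσ hΦ hψ hτ hA'0 hlam hQ'0 (hμ0 k) (hι₁ k hk1 hkK) (hι₂ k hk1 hkK) (hι₃ k hk1 hkK) (hprof k hk1 hkK) hx₁ hx₂ hx₃ hy hθ
    (fun N hN hg => hstep₂ k hk1 hkK (hZall k hk1 hkK) N hN hg)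

/-- **The two-leg track-`0` floor unit is `ε·4^{−J}`**: `klLevUnitF β M 0 1 J = imagTimeWeight β M · (4^J)⁻¹` — the `(4^{·})⁻¹` level scaling of the (E2) row.
[cite: BenfattoGiulianiMastropietro2006, §2.8 (2.76)-(2.77)] -/
theorem klLevUnitF_zero_one (β : ℝ) (M J : ℕ) : klLevUnitF β M 0 1 J = imagTimeWeight β M * ((4 : ℝ) ^ J)⁻¹ := by
  unfold klLevUnitF
  have h8 : (8 : ℝ) ^ J ≠ 0 := by positivity
  have h32 : (2 : ℝ) ^ (5 * J) = (8 : ℝ) ^ J * (4 : ℝ) ^ J := by rw [pow_mul, ← mul_pow]; norm_num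
  rw [show klLevGain 0 = 0 from rfl, h32]
  simp only [zero_mul, pow_zero, mul_one, show 2 * 1 - 1 = 1 from rfl, pow_one]
  field_simp

/-- **THE TWO-LEG TADPOLE-FREE ROW, PINNED-SUM FORM** (what the (E2) reader's `hsup/h₀–h₃` chain and #17-Z's `shellRow_spaceMomentPow_le_of_klWtPinnedSumPow` read, by
`klWtPinnedSumPow_le_klTowerBornWtPowSubTadAt`): under the hypotheses of `klTowerBornWtPowSubTadAt_two_le_of_rows`, at every block `1 ≤ k ≤ K_b` and every pin `(q, w)`,
`klWtPinnedSumPow … (dk) j Dw 2 (Δ_k − Δ_Γ 𝒱_{dk}) q w ≤ X₂ · klLevUnitF β M 0 1 (dk)` (`= X₂·ε·4^{−dk}`, `klLevUnitF_zero_one`), `X₂` the closed form of that theorem.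
[cite: BenfattoGiulianiMastropietro2006, (2.70)-(2.71a), §2.8 (2.76)-(2.77), (2.83)] -/
theorem klWtPinnedSumPow_two_subTad_le_of_rows {β : ℝ} (hβ : 0 < β) [NeZero M] (U μ : ℝ) (K : TrigPolyC4v)
    (j d Kb D Dw : ℕ) {lam W Z A' Q' σ Φ ψ τ ι₁ ι₂ ι₃ : ℝ} {Zk : ℕ → Prop}
    (hlam : 0 < lam) (hA'0 : 0 ≤ A') (hQ'0 : 0 < Q') (hσ : 0 ≤ σ) (hΦ : 0 ≤ Φ) (hψ : 0 ≤ ψ) (hτ : 0 < τ)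
    (hμ0 : ∀ k m, 0 ≤ W * Z ^ m * (klTowerMeasWtPowAt L M β U μ K d k j Dw (2 * m) / klLevUnitF β M 0 m (d * k - 1)))
    (hprof : ∀ k, 1 ≤ k → k ≤ Kb → ∀ m, 4 ≤ m → m ≤ D →
      W * Z ^ m * (klTowerMeasWtPowAt L M β U μ K d k j Dw (2 * m) / klLevUnitF β M 0 m (d * k - 1)) ≤ A' * lam ^ (m - 1) * Q' ^ m)
    (hι₁ : ∀ k, 1 ≤ k → k ≤ Kb → W * Z ^ 1 * (klTowerMeasWtPowAt L M β U μ K d k j Dw (2 * 1) / klLevUnitF β M 0 1 (d * k - 1)) ≤ ι₁ * lam)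
    (hι₂ : ∀ k, 1 ≤ k → k ≤ Kb → W * Z ^ 2 * (klTowerMeasWtPowAt L M β U μ K d k j Dw (2 * 2) / klLevUnitF β M 0 2 (d * k - 1)) ≤ ι₂ * lam)
    (hι₃ : ∀ k, 1 ≤ k → k ≤ Kb → W * Z ^ 3 * (klTowerMeasWtPowAt L M β U μ K d k j Dw (2 * 3) / klLevUnitF β M 0 3 (d * k - 1)) ≤ ι₃ * lam ^ 2)
    (hZall : ∀ k, 1 ≤ k → k ≤ Kb → Zk k)
    (hstep₂ : ∀ k, 1 ≤ k → k ≤ Kb → Zk k → ∀ N : ℕ, 2 ≤ N →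
      Φ * towerV D τ (fun m => W * Z ^ m * (klTowerMeasWtPowAt L M β U μ K d k j Dw (2 * m) / klLevUnitF β M 0 m (d * k - 1))) < 1 →
      klTowerBornWtPowSubTadAt L M β U μ K d k j Dw 2 / klLevUnitF β M 0 1 (d * k) ≤
        towerFO D σ (fun m => if 2 < m then W * Z ^ m * (klTowerMeasWtPowAt L M β U μ K d k j Dw (2 * m) / klLevUnitF β M 0 m (d * k - 1)) else 0) 1 +
          ∑ n ∈ Icc 2 N, exp 1 * Φ ^ (n - 1) * ψ ^ 1 *
            towerS D τ (fun m => W * Z ^ m * (klTowerMeasWtPowAt L M β U μ K d k j Dw (2 * m) / klLevUnitF β M 0 m (d * k - 1))) n 1 +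
          ψ ^ 1 * exp 1 * towerV D τ (fun m => W * Z ^ m * (klTowerMeasWtPowAt L M β U μ K d k j Dw (2 * m) / klLevUnitF β M 0 m (d * k - 1))) *
            (Φ * towerV D τ (fun m => W * Z ^ m * (klTowerMeasWtPowAt L M β U μ K d k j Dw (2 * m) / klLevUnitF β M 0 m (d * k - 1)))) ^ N /
            (1 - Φ * towerV D τ (fun m => W * Z ^ m * (klTowerMeasWtPowAt L M β U μ K d k j Dw (2 * m) / klLevUnitF β M 0 m (d * k - 1)))))
    (hx₁ : 4 * σ * lam * Q' < 1) (hx₂ : 2 * lam * τ * Q' ≤ 1) (hx₃ : exp 1 * τ * lam * Q' < 1)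
    (hy : Φ * (τ * (ι₁ * lam + ι₂ / (2 * Q') + ι₃ / (4 * Q' ^ 2) + A' * Q' / 4)) < 1)
    (hθ : Φ * (exp 1 * τ * (ι₁ * lam) + (exp 1 * τ) ^ 2 * (ι₂ * lam) + (exp 1 * τ) ^ 3 * (ι₃ * lam ^ 2) +
      A' * (exp 1 * τ * Q') * ((exp 1 * τ * lam * Q') ^ 3 / (1 - exp 1 * τ * lam * Q'))) < 1)
    {k : ℕ} (hk1 : 1 ≤ k) (hkK : k ≤ Kb) (q : Fin 2) (w : SpaceTimeIdx L M × SectorLeg (sectorCount (d * k))) :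
    klWtPinnedSumPow L M β μ K (d * k) j Dw 2
        (klTowerIncr L M β U μ K d k -
          grassmannLaplacian ℂ (hubbardCovSliceCT L M β μ 0 K (klScale klE0 (d * (k + 1))) (klScale klE0 (d * k))) (klTowerInput L M β U μ K d k)) q w ≤
      (15 * σ ^ 2 * (ι₃ * lam ^ 2) + A' * (4 * Q') * ((4 * σ * lam * Q') ^ 3 / (1 - 4 * σ * lam * Q')) +
          exp 1 * ψ * (τ * (ι₁ * lam + ι₂ / (2 * Q') + ι₃ / (4 * Q' ^ 2) + A' * Q' / 4)) *
            (Φ * (τ * (ι₁ * lam + ι₂ / (2 * Q') + ι₃ / (4 * Q' ^ 2) + A' * Q' / 4)) /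
              (1 - Φ * (τ * (ι₁ * lam + ι₂ / (2 * Q') + ι₃ / (4 * Q' ^ 2) + A' * Q' / 4))))) *
        klLevUnitF β M 0 1 (d * k) := by
  have hU0 : 0 < klLevUnitF β M 0 1 (d * k) := klLevUnitF_pos hβ 0 _ _
  have h := klTowerBornWtPowSubTadAt_two_le_of_rows (L := L) (M := M) U μ K j d Kb D Dw hlam hA'0 hQ'0 hσ hΦ hψ hτ hμ0 hprof hι₁ hι₂ hι₃ hZall hstep₂
    hx₁ hx₂ hx₃ hy hθ k hk1 hkK
  rw [div_le_iff₀ hU0] at h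
  exact (klWtPinnedSumPow_le_klTowerBornWtPowSubTadAt β U μ K d k j Dw 2 q w).trans h

end Export

end Summit.HubbardSuperconductivity.HubbardSuperconductivity.Theorems.EngineV8

end
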